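import Summits.BirchSwinnertonDyer.BirchSwinnertonDyer.Theorems.AlignedTransportAtTwoMainConjectureOfRankZeroBSDAtTwoOrdinaryStandardShapeCMSextic
import Summits.BirchSwinnertonDyer.BirchSwinnertonDyer.Theorems.AlignedTransportAtTwoMainConjectureOfRankZeroBSDAtTwoOrdinaryStandardShapeWitness
import HarnessLib

/-!
# Route `AlignedTransportAtTwo`, crux C2 `MainConjectureOfRankZeroBSDAtTwo` (stmt-BirchSwinnertonDyer-22298):
# THE CM-SEXTIC SHAPE, SIGN-SPLIT — on `Δ[1,a₂,0,a₄,a₆] < 0` triples the CM clause «`μ₂ = 0` for `ℚ(e, √−1)`» IS the plain clause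
# «`μ₂ = 0` for the cubic `ℚ(e)`» (Iwasawa's `μ`-conjecture for complex `S₃`-cubics: no `√−1`, no narrow datum); the `√−1` is needed only on
# `Δ > 0` (totally real root fields); the signature of the root field is read on the integer triple; both halves are non-vacuous

HONEST FRAMING. WIDTH-5 attached prover seat `bsd-line-att-p4` g36 on line `birth` of the lead `bsd-line-att-p2` (WAKE-only); `--supports`
stmt-BirchSwinnertonDyer-22298, closes nothing; BSD is NOT proved; crux C2, its verdict «blocked-on `Rank1Residual.GreenbergMuConjectureIrreducible`»
and every registered stub (P / T / Kμ / LimDoor / MuIneqʳ / PFμ⁺ of `Lines/birth.lean` v9) untouched. THEOREMS ONLY (no `def`, no named fact, no `sorry`).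
§1–§2 and §4 are UNCONDITIONAL statements ABOUT the restatements (dictionary, equivalence, non-vacuity) — nothing is asserted about any `μ`-invariant;
§3 is CONDITIONAL on displayed named print facts (PRINT⁵ = Kato 17.4 (1)(2) at `2` `h17`, Greenberg 1999 Thm. 4.1 `hGr`, period unit `hper`, modularity
`hmod`, GZK `hGZK`) and on the registered stub MuIneqʳ VERBATIM (`hI`). Sequel of `…OrdinaryStandardShapeCMSextic` (this seat, same gen: SHAPE_CM ⟺
LOCAL_CM ⟺ LOCAL ⟺ SHAPE; C2 and PFμ⁺ by name from SHAPE_CM), whose notation SHAPE / SHAPE_CM / LOCAL / LOCAL_CM is kept.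

* §1 `not_isSquare_neg_two_mul_Δ_standard` (`−2Δ ∉ ℚ²`, `Δ` odd), ★★ `isTotallyReal_iff_Δ_pos_of_standardShape_root` — **a cubic number field containing a
  root of a shape cubic is totally real ⟺ `Δ[1,a₂,0,a₄,a₆] > 0`** (g33's signature dictionary on the standard curve `[1,a₂,0,a₄,a₆] ⊗ ℚ`).
* §2 ★★★ `shapeCM_iff_signSplit` — **SHAPE_CM ⟺ SHAPE⁻ ∧ SHAPE⁺_CM** with SHAPE⁻ := «∀ triples with `a₄ + a₆` odd, no rational root, `Δ < 0`: plain
  `μ₂(F^cyc) = 0` for every CUBIC `F ∋` root» (Iwasawa's `μ`-conjecture for the complex `S₃`-cubic root fields — no `√−1`, no narrow datum, `Δ ∉ ℤ²`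
  automatic) and SHAPE⁺_CM := SHAPE_CM on `Δ > 0` (the CM sextics over the totally real root fields). ⟸ on `Δ < 0` runs through the cubic model `ℚ⟮β₀⟯` of
  the standard curve, att-p3 g34's `Δ < 0` dictionary `classicalMuVanishes_pointFieldCM_iff_cubic_of_Δ_neg`, and g32's transport to the abstract `F′`.
* §3 ★★ `crux_of_signSplit_standardShape` — SHAPE⁻ ∧ SHAPE⁺_CM + PRINT⁵ + MuIneqʳ ⟹ `MainConjectureOfRankZeroBSDAtTwo`.
* §4 A3 — `exists_cubicField_root_of_standardShape`, `exists_sexticField_root_sqrt_neg_one_of_standardShape`: the binders of SHAPE / SHAPE⁻ / SHAPE_CM are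
  INHABITED AT EVERY admissible triple (the models `ℚ⟮β₀⟯`, `ℚ⟮β₀⟯ ⊔ ℚ⟮i₀⟯` of the standard curve); the `Δ > 0` triple `(−1,−2,1)` (`x³ − 3x² − 32x + 64`,
  no root mod `7`, `Δ = 575 = 5²·23 ∉ ℤ²`; `exists_standardShape_witness_Δ_pos`, `exists_totallyReal_cubicField_and_sexticField_witness`) complements g35's
  `Δ < 0` triple `(0,0,1)` (`Δ = −433`): both halves of §2 are non-vacuous, at the triple and at the field level.
READING (restatement menu, D-0014): filed sign-split, C2's open classical input in triple currency is the pair {«`μ₂(ℚ(e)^cyc) = 0`, `e` a root of a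
`Δ < 0` shape cubic» (= Iwasawa's `μ₂`-conjecture for complex `S₃`-cubics, g33's (Iμ⁻) indexed by integer triples), «`μ₂(ℚ(e, √−1)^cyc) = 0`, `e` a root of a
`Δ > 0`, `Δ ∉ ℤ²` shape cubic» (= Iwasawa's `μ₂`-conjecture for the CM sextics over totally real `S₃`-cubics, g33's (Gμ⁺) with Kida's narrow datum traded
for `√−1`)}. Both OPEN IN PRINT; nothing is asserted about them. Expected REF2 grade COROLLARY-OF-TREE. PARTITION: none; beyond-print theorem: no; BSD is
NOT proved by any of this.

References: [Greenberg2001IwasawaPastPresent] §4; [Iwasawa1973MuInvariants] Thm. 2–3, §3; [Kida1982JFields] Remark (ii); [Cohen1993] Prop. 4.8.11;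
[Kato2004Asterisque] Thm. 17.4; [GreenbergLNM1716] Thm. 4.1; [SilvermanAEC2009] III.§1, III.2.3, VIII.§1; tree: `…OrdinaryStandardShapeCMSextic` (this seat),
`…OrdinaryStandardShape{,Exact,Crux,Witness}` (g35), `…NarrowCubicNamedInputSignSplit` (g33), `…PointFieldCarrierCMIff` (att-p3 g34), `…CMSexticCurrency` /
`…CMSexticFieldDoor` (g32), `Rank1Residual/X5/TwoAdicImageCertificates` (`O1`).
-/

-- the Theorems namespace of this sub repeats the summit name by design (D-0017 nested layout)
set_option linter.dupNamespace false
set_option autoImplicit false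

noncomputable section

open scoped NumberField IntermediateField

namespace Summit.BirchSwinnertonDyer.BirchSwinnertonDyer.Theorems.AlignedTransportAtTwoOrdinaryStandardShapeCMSexticSign

open NumberField Polynomial WeierstrassCurve IntermediateField Field CongruenceSubgroup
  Literature.NumberTheory.EllipticCurves Literature.NumberTheory.EllipticCurves.Greenberg1999
  Literature.NumberTheory.EllipticCurves.ModularForms Literature.NumberTheory.EllipticCurves.Rank1Residual
  Literature.NumberTheory.EllipticCurves.Module
  Literature.NumberTheory.EllipticCurves.DokchitserDokchitser2012
  Literature.NumberTheory.EllipticCurves.ZpExtension Literature.NumberTheory.GaloisRepresentations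
  Literature.NumberTheory.IwasawaTheory Literature.NumberTheory.NumberFields
  Summit.BirchSwinnertonDyer.Rank1Residual Summit.BirchSwinnertonDyer.Rank1Residual.X1.MuLambda
  Summit.BirchSwinnertonDyer.Rank1Residual.X5 Summit.BirchSwinnertonDyer.Rank1Residual.F1Sign2
  Summit.BirchSwinnertonDyer.BirchSwinnertonDyer.Theorems.Rank1ResidualX1Defs
  Summit.BirchSwinnertonDyer.BirchSwinnertonDyer.Theses.AlignedTransportAtTwo
  Summit.BirchSwinnertonDyer.BirchSwinnertonDyer.Theorems.AlignedTransportAtTwoNarrowCubicNamedInput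
  Summit.BirchSwinnertonDyer.BirchSwinnertonDyer.Theorems.AlignedTransportAtTwoNarrowCubicNamedInputSignSplit
  Summit.BirchSwinnertonDyer.BirchSwinnertonDyer.Theorems.AlignedTransportAtTwoOrdinaryStandardShape
  Summit.BirchSwinnertonDyer.BirchSwinnertonDyer.Theorems.AlignedTransportAtTwoOrdinaryStandardShapeExact
  Summit.BirchSwinnertonDyer.BirchSwinnertonDyer.Theorems.AlignedTransportAtTwoOrdinaryStandardShapeCrux
  Summit.BirchSwinnertonDyer.BirchSwinnertonDyer.Theorems.AlignedTransportAtTwoOrdinaryStandardShapeWitness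
  Summit.BirchSwinnertonDyer.BirchSwinnertonDyer.Theorems.AlignedTransportAtTwoOrdinaryStandardShapeCMSextic
  Summit.BirchSwinnertonDyer.BirchSwinnertonDyer.Theorems.AlignedTransportAtTwoPointFieldCarrierCM
  Summit.BirchSwinnertonDyer.BirchSwinnertonDyer.Theorems.AlignedTransportAtTwoPointFieldCarrierCMIff
  Summit.BirchSwinnertonDyer.BirchSwinnertonDyer.Theorems.AlignedTransportAtTwoPointFieldCarrierGalois
  Summit.BirchSwinnertonDyer.BirchSwinnertonDyer.Theorems.AlignedTransportAtTwoSharedCubicDivisionField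
  Summit.BirchSwinnertonDyer.BirchSwinnertonDyer.Theorems.AlignedTransportAtTwoCMSexticCurrency
  Summit.BirchSwinnertonDyer.BirchSwinnertonDyer.Theorems.AlignedTransportAtTwoCMSexticFieldDoor

/-! ## §1–§3 The sign split in triple currency: `Δ[1,a₂,0,a₄,a₆] < 0` (complex cubic root field, plain `μ₂`) vs `> 0` (totally real, CM sextic) -/

section Sign

variable {a₂ a₄ a₆ : ℤ}

/-- **`−2·Δ[1,a₂,0,a₄,a₆] ∉ ℚ²` when `a₄ + a₆` is odd** (`Δ` is odd, so `v₂(−2Δ) = 1`). [folklore] -/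
theorem not_isSquare_neg_two_mul_Δ_standard (hodd : Odd (a₄ + a₆)) :
    ¬ IsSquare (-2 * ((⟨1, a₂, 0, a₄, a₆⟩ : WeierstrassCurve ℤ).baseChange ℚ).Δ) := by
  rw [Δ_standard_baseChange]
  intro h
  have hZ : IsSquare (-2 * (⟨1, a₂, 0, a₄, a₆⟩ : WeierstrassCurve ℤ).Δ) := by
    have h' : IsSquare (((-2 * (⟨1, a₂, 0, a₄, a₆⟩ : WeierstrassCurve ℤ).Δ : ℤ) : ℚ)) := by push_cast; exact h
    exact Rat.isSquare_intCast_iff.mp h'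
  obtain ⟨s, hs⟩ := hZ
  have hev : Even (s * s) := ⟨-(⟨1, a₂, 0, a₄, a₆⟩ : WeierstrassCurve ℤ).Δ, by linarith⟩
  obtain ⟨t, ht⟩ : Even s := by simpa using Int.even_mul.mp hev
  have hΔev : Even (⟨1, a₂, 0, a₄, a₆⟩ : WeierstrassCurve ℤ).Δ := ⟨-(t * t), by rw [ht] at hs; linarith⟩
  exact Int.not_even_iff_odd.mpr ((odd_Δ_standard_iff a₂ a₄ a₆).mpr hodd) hΔev

/-- ★★ **A cubic number field containing a root of a shape cubic is TOTALLY REAL ⟺ `Δ[1,a₂,0,a₄,a₆] > 0`** (`a₄ + a₆` odd, no rational root): the signature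
of the root field read on the integer triple (g33's `isTotallyReal_iff_Δ_pos_of_root` on the standard curve `[1,a₂,0,a₄,a₆] ⊗ ℚ`, whose `u`-cubic IS the
shape cubic; `disc = 256·Δ`). [cite: Cohen1993, Prop. 4.8.11 (`sign d(K) = (−1)^{r₂}`)] [cite: SilvermanAEC2009, III.§1] -/
theorem isTotallyReal_iff_Δ_pos_of_standardShape_root (hodd : Odd (a₄ + a₆))
    (hirr : ∀ x : ℚ, x ^ 3 + (1 + 4 * (a₂ : ℚ)) * x ^ 2 + 16 * (a₄ : ℚ) * x + 64 * (a₆ : ℚ) ≠ 0)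
    {F : Type} [Field F] [NumberField F] (hF : Module.finrank ℚ F = 3) {e : F}
    (he : e ^ 3 + (1 + 4 * (a₂ : F)) * e ^ 2 + 16 * (a₄ : F) * e + 64 * (a₆ : F) = 0) :
    IsTotallyReal F ↔ 0 < (⟨1, a₂, 0, a₄, a₆⟩ : WeierstrassCurve ℤ).Δ := by
  haveI hE := isElliptic_standard a₂ a₄ a₆ hodd
  have ht := not_hasRationalTwoTorsionX_standard a₂ a₄ a₆ hirr
  have heV : aeval e (twoDivisionUCubic ((⟨1, a₂, 0, a₄, a₆⟩ : WeierstrassCurve ℤ).baseChange ℚ)) = 0 := by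
    rw [aeval_twoDivisionUCubic_standard]; exact he
  rw [isTotallyReal_iff_Δ_pos_of_root _ ht hF heV, Δ_standard_baseChange, Int.cast_pos]

/-- **A negative integer is not a square.** [folklore] -/
theorem not_isSquare_of_neg {d : ℤ} (hd : d < 0) : ¬ IsSquare d := by
  rintro ⟨r, hr⟩
  nlinarith [mul_self_nonneg r]

/-- ★★★ **THE SIGN SPLIT OF SHAPE_CM IN TRIPLE CURRENCY.** SHAPE_CM ⟺ SHAPE⁻ ∧ SHAPE⁺_CM, where
SHAPE⁻ := «for all integers `a₂, a₄, a₆` with `a₄ + a₆` odd, `x³ + (1+4a₂)x² + 16a₄x + 64a₆` without rational root and `Δ[1,a₂,0,a₄,a₆] < 0`, every CUBIC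
number field `F ∋ e` with `g(e) = 0` has `μ₂ = 0` along every cyclotomic `ℤ₂`-extension» — Iwasawa's `μ`-conjecture for the complex `S₃`-cubic root fields,
with NO `√−1`, NO narrow datum and NO `Δ ∉ ℤ²` clause (automatic); and SHAPE⁺_CM := SHAPE_CM restricted to `Δ[1,a₂,0,a₄,a₆] > 0` (CM sextics over the
totally real root fields). ⟹: SHAPE_CM ⟺ SHAPE (`…CMSextic` §4) and clause (a); ⟸ on `Δ < 0`: the cubic model `ℚ⟮β₀⟯` of the standard curve `[1,a₂,0,a₄,a₆] ⊗ ℚ` (elliptic, `E(ℚ)[2] = 0`,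
`Δ < 0`, `−2Δ ∉ ℚ²`) carries SHAPE⁻, att-p3 g34's `Δ < 0` dictionary `classicalMuVanishes_pointFieldCM_iff_cubic_of_Δ_neg` lifts it to `ℚ⟮β₀⟯ ⊔ ℚ⟮i₀⟯`,
g32's transport carries it to the abstract `F′`. UNCONDITIONAL; nothing asserted about any `μ`. [cite: Greenberg2001IwasawaPastPresent, §4 (Iwasawa's μ = 0 conjecture)]
[cite: Iwasawa1973MuInvariants, Thm. 2 and Thm. 3, §3] [cite: Cohen1993, Prop. 4.8.11] [cite: Kida1982JFields, Remark (ii) (p. 341)] -/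
theorem shapeCM_iff_signSplit :
    (∀ a₂ a₄ a₆ : ℤ, Odd (a₄ + a₆) →
      (∀ x : ℚ, x ^ 3 + (1 + 4 * (a₂ : ℚ)) * x ^ 2 + 16 * (a₄ : ℚ) * x + 64 * (a₆ : ℚ) ≠ 0) →
      ¬ IsSquare (⟨1, a₂, 0, a₄, a₆⟩ : WeierstrassCurve ℤ).Δ →
      ∀ (F' : Type) [Field F'] [NumberField F'], Module.finrank ℚ F' = 6 →
      ∀ e i : F', e ^ 3 + (1 + 4 * (a₂ : F')) * e ^ 2 + 16 * (a₄ : F') * e + 64 * (a₆ : F') = 0 → i ^ 2 = -1 →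
      ∀ κ : ZpExtension F' 2, κ.IsCyclotomic → ClassicalMuVanishes κ) ↔
    ((∀ a₂ a₄ a₆ : ℤ, Odd (a₄ + a₆) →
        (∀ x : ℚ, x ^ 3 + (1 + 4 * (a₂ : ℚ)) * x ^ 2 + 16 * (a₄ : ℚ) * x + 64 * (a₆ : ℚ) ≠ 0) →
        (⟨1, a₂, 0, a₄, a₆⟩ : WeierstrassCurve ℤ).Δ < 0 →
        ∀ (F : Type) [Field F] [NumberField F], Module.finrank ℚ F = 3 →
        ∀ e : F, e ^ 3 + (1 + 4 * (a₂ : F)) * e ^ 2 + 16 * (a₄ : F) * e + 64 * (a₆ : F) = 0 →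
        ∀ κ : ZpExtension F 2, κ.IsCyclotomic → ClassicalMuVanishes κ) ∧
      (∀ a₂ a₄ a₆ : ℤ, Odd (a₄ + a₆) →
        (∀ x : ℚ, x ^ 3 + (1 + 4 * (a₂ : ℚ)) * x ^ 2 + 16 * (a₄ : ℚ) * x + 64 * (a₆ : ℚ) ≠ 0) →
        0 < (⟨1, a₂, 0, a₄, a₆⟩ : WeierstrassCurve ℤ).Δ → ¬ IsSquare (⟨1, a₂, 0, a₄, a₆⟩ : WeierstrassCurve ℤ).Δ →
        ∀ (F' : Type) [Field F'] [NumberField F'], Module.finrank ℚ F' = 6 →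
        ∀ e i : F', e ^ 3 + (1 + 4 * (a₂ : F')) * e ^ 2 + 16 * (a₄ : F') * e + 64 * (a₆ : F') = 0 → i ^ 2 = -1 →
        ∀ κ : ZpExtension F' 2, κ.IsCyclotomic → ClassicalMuVanishes κ)) := by
  constructor
  · intro hS
    refine ⟨fun a₂ a₄ a₆ hodd hirr hneg F _ _ hF e he ↦ ?_,
      fun a₂ a₄ a₆ hodd hirr _ hnsq F' _ _ hF' e i he hi ↦ hS a₂ a₄ a₆ hodd hirr hnsq F' hF' e i he hi⟩
    exact ((narrowShape_iff_shapeCM.mpr hS) a₂ a₄ a₆ hodd hirr (not_isSquare_of_neg hneg) F hF e he).1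
  · rintro ⟨hN, hP⟩ a₂ a₄ a₆ hodd hirr hnsq F' _ _ hF' e i he hi
    have hΔ0 : (⟨1, a₂, 0, a₄, a₆⟩ : WeierstrassCurve ℤ).Δ ≠ 0 := fun h0 ↦ by
      have hΔodd := (odd_Δ_standard_iff a₂ a₄ a₆).mpr hodd
      rw [h0] at hΔodd
      exact (by decide : ¬ Odd (0 : ℤ)) hΔodd
    rcases hΔ0.lt_or_gt with hneg | hpos
    · -- `Δ < 0`: the cubic model of the standard curve carries SHAPE⁻; lift to the CM model; transport to `F′`
      haveI hE := isElliptic_standard a₂ a₄ a₆ hodd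
      have ht := not_hasRationalTwoTorsionX_standard a₂ a₄ a₆ hirr
      obtain ⟨i₀, hi₀⟩ : ∃ i₀ : AlgebraicClosure ℚ, i₀ ^ 2 = -1 := IsAlgClosed.exists_pow_nat_eq (-1) two_pos
      set B : IntermediateField ℚ (AlgebraicClosure ℚ) :=
        ℚ⟮xT ((⟨1, a₂, 0, a₄, a₆⟩ : WeierstrassCurve ℤ).baseChange ℚ) two_ne_zero 0⟯ with hB
      haveI : FiniteDimensional ℚ ↥B := adjoin.finiteDimensional ((AlgebraicClosure.isAlgebraic ℚ).isAlgebraic _).isIntegral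
      haveI : NumberField ↥B := NumberField.mk
      have h3 : Module.finrank ℚ ↥B = 3 := finrank_adjoin_xT_model _ ht 0
      have h4mem : (4 : AlgebraicClosure ℚ) * xT ((⟨1, a₂, 0, a₄, a₆⟩ : WeierstrassCurve ℤ).baseChange ℚ) two_ne_zero 0 ∈ B :=
        mul_mem (ofNat_mem B 4) (mem_adjoin_simple_self ℚ _)
      have heB : aeval (⟨4 * xT ((⟨1, a₂, 0, a₄, a₆⟩ : WeierstrassCurve ℤ).baseChange ℚ) two_ne_zero 0, h4mem⟩ : ↥B)
          (twoDivisionUCubic ((⟨1, a₂, 0, a₄, a₆⟩ : WeierstrassCurve ℤ).baseChange ℚ)) = 0 :=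
        aeval_mk_eq_zero_of_aeval_eq_zero _ B (aeval_four_mul_xT_twoDivisionUCubic _ 0) h4mem
      rw [aeval_twoDivisionUCubic_standard] at heB
      have hμB : ∀ κj : ZpExtension ↥B 2, κj.IsCyclotomic → ClassicalMuVanishes κj := hN a₂ a₄ a₆ hodd hirr hneg ↥B h3 _ heB
      have hΔV : ((⟨1, a₂, 0, a₄, a₆⟩ : WeierstrassCurve ℤ).baseChange ℚ).Δ < 0 := by
        rw [Δ_standard_baseChange]; exact_mod_cast hneg
      have hPm := (classicalMuVanishes_pointFieldCM_iff_cubic_of_Δ_neg _ ht hΔV (not_isSquare_neg_two_mul_Δ_standard hodd) hi₀ 0).mpr hμB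
      have heV : aeval e (twoDivisionUCubic ((⟨1, a₂, 0, a₄, a₆⟩ : WeierstrassCurve ℤ).baseChange ℚ)) = 0 := by
        rw [aeval_twoDivisionUCubic_standard]; exact he
      exact (forall_classicalMuVanishes_iff_pointFieldCM _ ht hF' heV hi 0 hi₀).mpr hPm
    · exact hP a₂ a₄ a₆ hodd hirr hpos hnsq F' hF' e i he hi

/-- ★★ **SHAPE⁻ ∧ SHAPE⁺_CM + PRINT⁵ + MuIneqʳ ⟹ C2 BY NAME** (the sign-split pair of §2 fed to `…CMSextic` §2). For each `W` of the cell exactly one hypothesis is used: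
SHAPE⁻ (plain `μ₂(F^cyc) = 0` for the complex cubic root fields) when `Δ_W < 0`, SHAPE⁺_CM (`μ₂ = 0` for the CM sextics `ℚ(e, √−1)` over the totally real
root fields) when `Δ_W > 0`. Both hypotheses are OPEN IN PRINT; nothing is asserted about them. CONDITIONAL; the item stays open; BSD is NOT proved.
[cite: Greenberg2001IwasawaPastPresent, §4 (Iwasawa's μ = 0 conjecture)] [cite: Kato2004Asterisque, Thm. 17.4 (p. 273) and §17.13 (pp. 279–280)]
[cite: GreenbergLNM1716, Thm. 4.1 (p. 102) and Conj. 1.11 (p. 58)] -/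
theorem crux_of_signSplit_standardShape
    (h17 : ∀ (V : WeierstrassCurve ℚ) [V.IsElliptic] [V.IsGloballyMinimal] [NeZero (V.conductorNorm ℤ)]
      (f : CuspForm (Gamma0 (V.conductorNorm ℤ)) 2), kato_divisibility_allPrimes V 2 (f := f))
    (hGr : Greenberg1999.thm41_charValue_rankZero_anyPrime)
    (hper : realPeriodRat_eq_unit_mul_plusPeriod_two) (hmod : nonempty_modularParametrizationData)
    (hGZK : rank_eq_analyticRank_of_analyticRank_le_one)
    (hI : ∀ (W : WeierstrassCurve ℚ) [W.IsElliptic] [W.IsGloballyMinimal], IsOrdinaryAt W 2 →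
      (∀ x : ℚ, ¬ HasRationalTwoTorsionX W x) →
      ∀ (κ : ZpExtension ℚ 2) (γ : Field.absoluteGaloisGroup ℚ), κ.IsCyclotomic →
      κ.IsTopGenerator γ → IsCyclotomicVariable 2 γ →
      ∀ ⦃N : ℕ⦄ [NeZero N] (f : CuspForm (Gamma0 N) 2), IsNewformOf W f →
      ∀ Gp : IwasawaAlgebra 2, iwasawaToPowerSeries 2 Gp = padicLFunction f (unitRoot W 2 : ℚ_[2]) →
      ∀ (D : W.SelmerDualData κ γ) (Yr : W.FineSelmerDualDataRelaxedInf κ γ),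
        lengthAt (IwasawaAlgebra 2) D.X ⟨IwasawaAlgebra.augIdealP 2, IwasawaAlgebra.isPrime_augIdealP_holds 2⟩ ≤
          lengthAt (IwasawaAlgebra 2) (IwasawaAlgebra 2 ⧸ Ideal.span {Gp})
              ⟨IwasawaAlgebra.augIdealP 2, IwasawaAlgebra.isPrime_augIdealP_holds 2⟩ +
            lengthAt (IwasawaAlgebra 2) Yr.X ⟨IwasawaAlgebra.augIdealP 2, IwasawaAlgebra.isPrime_augIdealP_holds 2⟩)
    (hN : ∀ a₂ a₄ a₆ : ℤ, Odd (a₄ + a₆) →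
      (∀ x : ℚ, x ^ 3 + (1 + 4 * (a₂ : ℚ)) * x ^ 2 + 16 * (a₄ : ℚ) * x + 64 * (a₆ : ℚ) ≠ 0) →
      (⟨1, a₂, 0, a₄, a₆⟩ : WeierstrassCurve ℤ).Δ < 0 →
      ∀ (F : Type) [Field F] [NumberField F], Module.finrank ℚ F = 3 →
      ∀ e : F, e ^ 3 + (1 + 4 * (a₂ : F)) * e ^ 2 + 16 * (a₄ : F) * e + 64 * (a₆ : F) = 0 →
      ∀ κ : ZpExtension F 2, κ.IsCyclotomic → ClassicalMuVanishes κ)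
    (hP : ∀ a₂ a₄ a₆ : ℤ, Odd (a₄ + a₆) →
      (∀ x : ℚ, x ^ 3 + (1 + 4 * (a₂ : ℚ)) * x ^ 2 + 16 * (a₄ : ℚ) * x + 64 * (a₆ : ℚ) ≠ 0) →
      0 < (⟨1, a₂, 0, a₄, a₆⟩ : WeierstrassCurve ℤ).Δ → ¬ IsSquare (⟨1, a₂, 0, a₄, a₆⟩ : WeierstrassCurve ℤ).Δ →
      ∀ (F' : Type) [Field F'] [NumberField F'], Module.finrank ℚ F' = 6 →
      ∀ e i : F', e ^ 3 + (1 + 4 * (a₂ : F')) * e ^ 2 + 16 * (a₄ : F') * e + 64 * (a₆ : F') = 0 → i ^ 2 = -1 →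
      ∀ κ : ZpExtension F' 2, κ.IsCyclotomic → ClassicalMuVanishes κ) :
    MainConjectureOfRankZeroBSDAtTwo :=
  crux_of_forall_standardShape_cmSextic_classicalMu h17 hGr hper hmod hGZK hI (shapeCM_iff_signSplit.mpr ⟨hN, hP⟩)

end Sign

/-! ## §4 A3: the binders are inhabited at every admissible triple; a `Δ > 0` witness -/

section Witness

variable {a₂ a₄ a₆ : ℤ}

/-- **The SHAPE binder is inhabited at EVERY admissible triple (cubic form)**: for `a₄ + a₆` odd and the shape cubic without rational root there is a cubic
NUMBER FIELD containing a root of it — the model `ℚ⟮β₀⟯ ∋ 4β₀` of the standard curve `[1,a₂,0,a₄,a₆] ⊗ ℚ` (elliptic, `E(ℚ)[2] = 0`). Generic form of g35's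
`exists_cubicField_standardShape_root` (triple `(0,0,1)`). [cite: SilvermanAEC2009, III.§1 and VIII.§1] -/
theorem exists_cubicField_root_of_standardShape (hodd : Odd (a₄ + a₆))
    (hirr : ∀ x : ℚ, x ^ 3 + (1 + 4 * (a₂ : ℚ)) * x ^ 2 + 16 * (a₄ : ℚ) * x + 64 * (a₆ : ℚ) ≠ 0) :
    ∃ (F : Type) (_ : Field F) (_ : NumberField F), Module.finrank ℚ F = 3 ∧
      ∃ e : F, e ^ 3 + (1 + 4 * (a₂ : F)) * e ^ 2 + 16 * (a₄ : F) * e + 64 * (a₆ : F) = 0 := by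
  haveI hE := isElliptic_standard a₂ a₄ a₆ hodd
  have ht := not_hasRationalTwoTorsionX_standard a₂ a₄ a₆ hirr
  set B : IntermediateField ℚ (AlgebraicClosure ℚ) :=
    ℚ⟮xT ((⟨1, a₂, 0, a₄, a₆⟩ : WeierstrassCurve ℤ).baseChange ℚ) two_ne_zero 0⟯ with hB
  haveI : FiniteDimensional ℚ ↥B := adjoin.finiteDimensional ((AlgebraicClosure.isAlgebraic ℚ).isAlgebraic _).isIntegral
  haveI : NumberField ↥B := NumberField.mk
  have h3 : Module.finrank ℚ ↥B = 3 := finrank_adjoin_xT_model _ ht 0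
  have h4mem : (4 : AlgebraicClosure ℚ) * xT ((⟨1, a₂, 0, a₄, a₆⟩ : WeierstrassCurve ℤ).baseChange ℚ) two_ne_zero 0 ∈ B :=
    mul_mem (ofNat_mem B 4) (mem_adjoin_simple_self ℚ _)
  have he : aeval (⟨4 * xT ((⟨1, a₂, 0, a₄, a₆⟩ : WeierstrassCurve ℤ).baseChange ℚ) two_ne_zero 0, h4mem⟩ : ↥B)
      (twoDivisionUCubic ((⟨1, a₂, 0, a₄, a₆⟩ : WeierstrassCurve ℤ).baseChange ℚ)) = 0 :=
    aeval_mk_eq_zero_of_aeval_eq_zero _ B (aeval_four_mul_xT_twoDivisionUCubic _ 0) h4mem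
  rw [aeval_twoDivisionUCubic_standard] at he
  exact ⟨↥B, inferInstance, inferInstance, h3, _, he⟩

/-- **The SHAPE_CM binder is inhabited at EVERY admissible triple (sextic form)**: for `a₄ + a₆` odd and the shape cubic without rational root there is a
NUMBER FIELD OF DEGREE `6` containing a root of it and a square root of `−1` — the model `ℚ⟮β₀⟯ ⊔ ℚ⟮i₀⟯ ∋ 4β₀, i₀` of the standard curve (degree `6` by
att-p3 g35's `finrank_adjoin_xT_sup_adjoin_I`). [cite: SilvermanAEC2009, III.§1 and VIII.§1] [cite: MilneFT2022, Ch. 3 (degrees of composita)] -/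
theorem exists_sexticField_root_sqrt_neg_one_of_standardShape (hodd : Odd (a₄ + a₆))
    (hirr : ∀ x : ℚ, x ^ 3 + (1 + 4 * (a₂ : ℚ)) * x ^ 2 + 16 * (a₄ : ℚ) * x + 64 * (a₆ : ℚ) ≠ 0) :
    ∃ (F' : Type) (_ : Field F') (_ : NumberField F'), Module.finrank ℚ F' = 6 ∧
      ∃ e i : F', e ^ 3 + (1 + 4 * (a₂ : F')) * e ^ 2 + 16 * (a₄ : F') * e + 64 * (a₆ : F') = 0 ∧ i ^ 2 = -1 := by
  haveI hE := isElliptic_standard a₂ a₄ a₆ hodd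
  have ht := not_hasRationalTwoTorsionX_standard a₂ a₄ a₆ hirr
  obtain ⟨i₀, hi₀⟩ : ∃ i₀ : AlgebraicClosure ℚ, i₀ ^ 2 = -1 := IsAlgClosed.exists_pow_nat_eq (-1) two_pos
  set P : IntermediateField ℚ (AlgebraicClosure ℚ) :=
    ℚ⟮xT ((⟨1, a₂, 0, a₄, a₆⟩ : WeierstrassCurve ℤ).baseChange ℚ) two_ne_zero 0⟯ ⊔
      IntermediateField.adjoin ℚ ({i₀} : Set (AlgebraicClosure ℚ)) with hP
  haveI : FiniteDimensional ℚ ↥(IntermediateField.adjoin ℚ ({i₀} : Set (AlgebraicClosure ℚ))) :=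
    adjoin.finiteDimensional ⟨X ^ 2 + 1, monic_X_pow_add_C _ two_ne_zero, by simp [hi₀]⟩
  haveI : FiniteDimensional ℚ ↥ℚ⟮xT ((⟨1, a₂, 0, a₄, a₆⟩ : WeierstrassCurve ℤ).baseChange ℚ) two_ne_zero 0⟯ :=
    adjoin.finiteDimensional ((AlgebraicClosure.isAlgebraic ℚ).isAlgebraic _).isIntegral
  haveI : FiniteDimensional ℚ ↥P := IntermediateField.finiteDimensional_sup _ _
  haveI : NumberField ↥P := NumberField.of_module_finite ℚ _
  have h6 : Module.finrank ℚ ↥P = 6 := finrank_adjoin_xT_sup_adjoin_I _ ht hi₀ 0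
  have he : aeval (⟨4 * xT ((⟨1, a₂, 0, a₄, a₆⟩ : WeierstrassCurve ℤ).baseChange ℚ) two_ne_zero 0,
      four_mul_xT_mem_sup _ 0 _⟩ : ↥P) (twoDivisionUCubic ((⟨1, a₂, 0, a₄, a₆⟩ : WeierstrassCurve ℤ).baseChange ℚ)) = 0 :=
    aeval_mk_eq_zero_of_aeval_eq_zero _ P (aeval_four_mul_xT_twoDivisionUCubic _ 0) (four_mul_xT_mem_sup _ 0 _)
  rw [aeval_twoDivisionUCubic_standard] at he
  exact ⟨↥P, inferInstance, inferInstance, h6, _, _, he, mk_sq_eq_neg_one P hi₀ (mem_sup_adjoin_self _ i₀)⟩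

/-- **`x³ − 3x² − 32x + 64` — the shape cubic of `(a₂, a₄, a₆) = (−1, −2, 1)` — has no rational root** (no root modulo `7`). [cite: SilvermanAEC2009, III.2.3 (b)] -/
theorem shape_m1_m2_1_ne_zero :
    ∀ x : ℚ, x ^ 3 + (1 + 4 * ((-1 : ℤ) : ℚ)) * x ^ 2 + 16 * ((-2 : ℤ) : ℚ) * x + 64 * ((1 : ℤ) : ℚ) ≠ 0 := by
  intro x hx
  refine Summit.BirchSwinnertonDyer.Rank1Residual.X5.O1.forall_cubic_ne_zero_of_forall_ne (c₂ := -3) (c₁ := -32) (c₀ := 64) (ℓ := 7)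
    (by decide) x ?_
  push_cast at hx ⊢
  linear_combination hx

/-- `Δ[1, −1, 0, −2, 1] = 575` (`= 5²·23 > 0`). [cite: SilvermanAEC2009, III.§1] -/
theorem Δ_m1_m2_1 : (⟨1, -1, 0, -2, 1⟩ : WeierstrassCurve ℤ).Δ = 575 := by
  rw [Δ_standard_eq]; norm_num

/-- `575` is not a square (`23² < 575 < 24²`). [folklore] -/
theorem not_isSquare_Δ_m1_m2_1 : ¬ IsSquare (⟨1, -1, 0, -2, 1⟩ : WeierstrassCurve ℤ).Δ := by
  rw [Δ_m1_m2_1]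
  rintro ⟨r, hr⟩
  rcases le_or_gt 24 r with h | h
  · nlinarith
  rcases le_or_gt r (-24) with h' | h'
  · nlinarith
  interval_cases r <;> omega

/-- ★ **THE `Δ > 0` HALF OF §5 IS NOT VACUOUS (triple level)**: `(a₂, a₄, a₆) = (−1, −2, 1)` has `a₄ + a₆` odd, shape cubic `x³ − 3x² − 32x + 64` without
rational root, and `Δ[1,−1,0,−2,1] = 575 > 0`, not a square — complementing g35's `Δ < 0` witness `(0, 0, 1)` (`Δ = −433`). By the generic lemmas above both binders (cubic and
sextic) are then inhabited. [cite: SilvermanAEC2009, III.§1 and III.2.3 (b)] -/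
theorem exists_standardShape_witness_Δ_pos :
    ∃ a₂ a₄ a₆ : ℤ, Odd (a₄ + a₆) ∧
      (∀ x : ℚ, x ^ 3 + (1 + 4 * (a₂ : ℚ)) * x ^ 2 + 16 * (a₄ : ℚ) * x + 64 * (a₆ : ℚ) ≠ 0) ∧
      0 < (⟨1, a₂, 0, a₄, a₆⟩ : WeierstrassCurve ℤ).Δ ∧ ¬ IsSquare (⟨1, a₂, 0, a₄, a₆⟩ : WeierstrassCurve ℤ).Δ :=
  ⟨-1, -2, 1, by decide, shape_m1_m2_1_ne_zero, by rw [Δ_m1_m2_1]; norm_num, not_isSquare_Δ_m1_m2_1⟩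

/-- ★ **Both halves of §2 are non-vacuous at the field level**: a totally real cubic number field containing a root of `x³ − 3x² − 32x + 64` and a sextic
number field containing such a root and `√−1` exist (the generic lemmas at `(−1,−2,1)`, totally real by §1); g35's `(0,0,1)` gives the complex-cubic half.
[cite: SilvermanAEC2009, III.§1 and VIII.§1] [cite: Cohen1993, Prop. 4.8.11] -/
theorem exists_totallyReal_cubicField_and_sexticField_witness :
    (∃ (F : Type) (_ : Field F) (_ : NumberField F), Module.finrank ℚ F = 3 ∧ IsTotallyReal F ∧
      ∃ e : F, e ^ 3 + (1 + 4 * ((-1 : ℤ) : F)) * e ^ 2 + 16 * ((-2 : ℤ) : F) * e + 64 * ((1 : ℤ) : F) = 0) ∧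
    ∃ (F' : Type) (_ : Field F') (_ : NumberField F'), Module.finrank ℚ F' = 6 ∧
      ∃ e i : F', e ^ 3 + (1 + 4 * ((-1 : ℤ) : F')) * e ^ 2 + 16 * ((-2 : ℤ) : F') * e + 64 * ((1 : ℤ) : F') = 0 ∧ i ^ 2 = -1 := by
  refine ⟨?_, exists_sexticField_root_sqrt_neg_one_of_standardShape (by decide) shape_m1_m2_1_ne_zero⟩
  obtain ⟨F, hF, hNF, h3, e, he⟩ := exists_cubicField_root_of_standardShape (a₂ := -1) (a₄ := -2) (a₆ := 1) (by decide) shape_m1_m2_1_ne_zero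
  exact ⟨F, hF, hNF, h3, (isTotallyReal_iff_Δ_pos_of_standardShape_root (by decide) shape_m1_m2_1_ne_zero h3 he).mpr
    (by rw [Δ_m1_m2_1]; norm_num), e, he⟩

end Witness

end Summit.BirchSwinnertonDyer.BirchSwinnertonDyer.Theorems.AlignedTransportAtTwoOrdinaryStandardShapeCMSexticSign

end
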